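import Literature.Algebra.Homology.HomologyFlatBaseChangeUnit
import Literature.Algebra.Homology.HomologyLocalizationMap
import HarnessLib

/-!
# `Z_i(K) → Z_i(S⁻¹R ⊗_R K)` and `K_i∕B_i → (S⁻¹R ⊗_R K)_i ∕ B_i` are localization maps: cycles and opcycles of a
# localized complex ARE the localized cycles and opcycles (universal-property form)

Layer `Literature/Algebra/Homology` (pure homological algebra over Mathlib; proved theorems only, 0 definitions, 0 named
facts, no instances, no notation). Row `HomologyLocalizationMap` proved that for a localization `A = S⁻¹R`
(`IsLocalization S A`) and the unit `η : K ⟶ A ⊗_R K`, `k ↦ 1 ⊗ k`, the map `H_i(η) : H_i(K) → H_i(A ⊗_R K)` is a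
localization map at `S` (`IsLocalizedModule S`). This file is the same for CYCLES `Z_i` and OPCYCLES `pZ_i = K_i ∕ B_i`
(Mathlib's `cycles`, `opcycles`), complexes of ANY shape, read off row `HomologyFlatBaseChangeUnit` (the unit-compatible
isomorphisms `Z_i(A ⊗_R K) ≃ A ⊗_R Z_i(K)`, `pZ_i(A ⊗_R K) ≃ A ⊗_R pZ_i(K)` for `A` flat) and Mathlib's
`IsLocalization.tensorProduct_isLocalizedModule` (`m ↦ 1 ⊗ m : M → S⁻¹R ⊗_R M` is a localization map) — so Mathlib's
`IsLocalizedModule ∕ LocalizedModule` API (`IsLocalizedModule.iso`, `.lift`, `.map_units`, `…_of_isLocalized_maximal`)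
applies to cycles and opcycles of complexes. Sources, VERBATIM: M. F. Atiyah, I. G. Macdonald, *Introduction to
Commutative Algebra* (1969), Ch. 3, Proposition 3.3 [held scan p0042 L16]: "The operation `S⁻¹` is exact";
Corollary 3.4 [p0043 L5]: "Formation of fractions commutes with formation of finite sums, finite intersections and
quotients." (kernels and cokernels); Proposition 3.5 [p0043 L21]: "there exists a unique isomorphism
`f : S⁻¹A ⊗_A M → S⁻¹M` for which `f((a/s) ⊗ m) = am/s`".

PROVED here: **`isLocalizedModule_cyclesMap_of_tmul_one`**, **`isLocalizedModule_opcyclesMap_of_tmul_one`**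
(`IsLocalizedModule S (Z_i(η))`, `IsLocalizedModule S (pZ_i(η))`); **`nonempty_localizedModule_cycles_linearEquiv`**,
**`nonempty_localizedModule_opcycles_linearEquiv`** (`S⁻¹Z_i(K) ≃ₗ[R] Z_i(A ⊗_R K)` with Mathlib's `LocalizedModule S`,
same for `pZ_i`); §2 the cases `R_𝔭` (`IsLocalizedModule.AtPrime`) and `R_f` (`IsLocalizedModule.Away`):
**`isLocalizedModule_cyclesMap_atPrime ∕ _away`**, **`isLocalizedModule_opcyclesMap_atPrime ∕ _away`**.

What is NOT here: homology (row `HomologyLocalizationMap`), boundaries `B_i` as a submodule (Mathlib's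
`HomologicalComplex` API is phrased with `cycles ∕ opcycles`), the `S⁻¹R`-module structures (the layer registers no
instances), sheaves and stalks (rows `AlgebraicGeometry/Modules/StalkCriteria`, `StalkExactCoherent`). Kin, named not
imported: `KerZeroOfQuasiIsoNatural` (`H⁰ = Ker d⁰` with `LinearMap.baseChange`, ℤ-cochains in degree `0`). Library
only (cell `pub-hodge-ring2`, count-neutral); proves nothing about any crux, route or conjecture.

## References

* M. F. Atiyah, I. G. Macdonald, *Introduction to Commutative Algebra*, Addison–Wesley (1969), Ch. 3, Prop. 3.3,
  Cor. 3.4, Prop. 3.5. [AtiyahMacdonald1969]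
-/

open CategoryTheory CategoryTheory.Limits CategoryTheory.MonoidalCategory HomologicalComplex TensorProduct

universe u w

namespace Literature.Algebra.Homology

/-! ### §1 `Z_i(K) → Z_i(A ⊗_R K)` and `pZ_i(K) → pZ_i(A ⊗_R K)` are localization maps -/

section Localization

variable {R : Type u} [CommRing R] (S : Submonoid R) (A : Type u) [CommRing A] [Algebra R A] [IsLocalization S A]
  {ι : Type w} {c : ComplexShape ι} (K : HomologicalComplex (ModuleCat.{u} R) c)
  (η : K ⟶ ((tensorLeft (ModuleCat.of R A)).mapHomologicalComplex c).obj K)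
  (hη : ∀ i (k : K.X i), (η.f i).hom k = (1 : A) ⊗ₜ[R] k)
include hη

/-- **Cycles commute with localization (universal-property form)**: for `A = S⁻¹R` and `η : K ⟶ A ⊗_R K` the unit,
`Z_i(η) : Z_i(K) → Z_i(A ⊗_R K)` is a localization of `Z_i(K)` at `S` (`IsLocalizedModule S`), i.e. `Z_i(S⁻¹K)` IS
`S⁻¹Z_i(K)` («Formation of fractions commutes with formation of finite sums, finite intersections and quotients»; kernels).
[cite: AtiyahMacdonald1969, Ch. 3 Prop. 3.3, Cor. 3.4, Prop. 3.5] -/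
theorem isLocalizedModule_cyclesMap_of_tmul_one (i : ι) : IsLocalizedModule S (cyclesMap η i).hom := by
  haveI : Module.Flat R A := IsLocalization.flat A S
  obtain ⟨e, he, -⟩ := exists_cycles_linearEquiv_of_tmul_one A K η hη i
  rw [(LinearEquiv.eq_toLinearMap_symm_comp _ _).2 he]
  exact IsLocalizedModule.of_linearEquiv S (TensorProduct.mk R A (K.cycles i) 1) e.symm

/-- **Opcycles `K_i ∕ B_i` commute with localization (universal-property form)**: `pZ_i(η) : pZ_i(K) → pZ_i(A ⊗_R K)` is a
localization at `S` (cokernels: «commutes with … quotients»). [cite: AtiyahMacdonald1969, Ch. 3 Prop. 3.3, Cor. 3.4, Prop. 3.5] -/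
theorem isLocalizedModule_opcyclesMap_of_tmul_one (i : ι) : IsLocalizedModule S (opcyclesMap η i).hom := by
  haveI : Module.Flat R A := IsLocalization.flat A S
  obtain ⟨e, he, -⟩ := exists_opcycles_linearEquiv_of_tmul_one A K η hη i
  rw [(LinearEquiv.eq_toLinearMap_symm_comp _ _).2 he]
  exact IsLocalizedModule.of_linearEquiv S (TensorProduct.mk R A (K.opcycles i) 1) e.symm

omit hη in
/-- `S⁻¹ Z_i(K) ≃ Z_i(A ⊗_R K)` (`R`-linearly; Mathlib's `LocalizedModule S` on the left).
[cite: AtiyahMacdonald1969, Ch. 3 Prop. 3.3, Cor. 3.4, Prop. 3.5] -/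
theorem nonempty_localizedModule_cycles_linearEquiv (i : ι) :
    Nonempty (LocalizedModule S (K.cycles i) ≃ₗ[R]
      (((tensorLeft (ModuleCat.of R A)).mapHomologicalComplex c).obj K).cycles i) := by
  obtain ⟨η, hη⟩ := exists_hom_tensorLeft_tmul_one A K
  haveI := isLocalizedModule_cyclesMap_of_tmul_one S A K η hη i
  exact ⟨IsLocalizedModule.iso S (cyclesMap η i).hom⟩

omit hη in
/-- `S⁻¹ pZ_i(K) ≃ pZ_i(A ⊗_R K)` (`R`-linearly). [cite: AtiyahMacdonald1969, Ch. 3 Prop. 3.3, Cor. 3.4, Prop. 3.5] -/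
theorem nonempty_localizedModule_opcycles_linearEquiv (i : ι) :
    Nonempty (LocalizedModule S (K.opcycles i) ≃ₗ[R]
      (((tensorLeft (ModuleCat.of R A)).mapHomologicalComplex c).obj K).opcycles i) := by
  obtain ⟨η, hη⟩ := exists_hom_tensorLeft_tmul_one A K
  haveI := isLocalizedModule_opcyclesMap_of_tmul_one S A K η hη i
  exact ⟨IsLocalizedModule.iso S (opcyclesMap η i).hom⟩

end Localization

/-! ### §2 The cases `R_𝔭` and `R_f` -/

section Cases

variable {R : Type u} [CommRing R] {ι : Type w} {c : ComplexShape ι} (K : HomologicalComplex (ModuleCat.{u} R) c)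

/-- `Z_i(K) → Z_i(R_𝔭 ⊗_R K)` is the localization of the cycles at the prime `𝔭`.
[cite: AtiyahMacdonald1969, Ch. 3 Prop. 3.3, Cor. 3.4, Prop. 3.5] -/
theorem isLocalizedModule_cyclesMap_atPrime (P : Ideal R) [P.IsPrime]
    (η : K ⟶ ((tensorLeft (ModuleCat.of R (Localization.AtPrime P))).mapHomologicalComplex c).obj K)
    (hη : ∀ i (k : K.X i), (η.f i).hom k = (1 : Localization.AtPrime P) ⊗ₜ[R] k) (i : ι) :
    IsLocalizedModule.AtPrime P (cyclesMap η i).hom :=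
  isLocalizedModule_cyclesMap_of_tmul_one P.primeCompl _ K η hη i

/-- `pZ_i(K) → pZ_i(R_𝔭 ⊗_R K)` is the localization of the opcycles at the prime `𝔭`.
[cite: AtiyahMacdonald1969, Ch. 3 Prop. 3.3, Cor. 3.4, Prop. 3.5] -/
theorem isLocalizedModule_opcyclesMap_atPrime (P : Ideal R) [P.IsPrime]
    (η : K ⟶ ((tensorLeft (ModuleCat.of R (Localization.AtPrime P))).mapHomologicalComplex c).obj K)
    (hη : ∀ i (k : K.X i), (η.f i).hom k = (1 : Localization.AtPrime P) ⊗ₜ[R] k) (i : ι) :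
    IsLocalizedModule.AtPrime P (opcyclesMap η i).hom :=
  isLocalizedModule_opcyclesMap_of_tmul_one P.primeCompl _ K η hη i

/-- `Z_i(K) → Z_i(R_f ⊗_R K)` is the localization of the cycles away from `f`.
[cite: AtiyahMacdonald1969, Ch. 3 Prop. 3.3, Cor. 3.4, Prop. 3.5] -/
theorem isLocalizedModule_cyclesMap_away (f : R)
    (η : K ⟶ ((tensorLeft (ModuleCat.of R (Localization.Away f))).mapHomologicalComplex c).obj K)
    (hη : ∀ i (k : K.X i), (η.f i).hom k = (1 : Localization.Away f) ⊗ₜ[R] k) (i : ι) :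
    IsLocalizedModule.Away f (cyclesMap η i).hom :=
  isLocalizedModule_cyclesMap_of_tmul_one (Submonoid.powers f) _ K η hη i

/-- `pZ_i(K) → pZ_i(R_f ⊗_R K)` is the localization of the opcycles away from `f`.
[cite: AtiyahMacdonald1969, Ch. 3 Prop. 3.3, Cor. 3.4, Prop. 3.5] -/
theorem isLocalizedModule_opcyclesMap_away (f : R)
    (η : K ⟶ ((tensorLeft (ModuleCat.of R (Localization.Away f))).mapHomologicalComplex c).obj K)
    (hη : ∀ i (k : K.X i), (η.f i).hom k = (1 : Localization.Away f) ⊗ₜ[R] k) (i : ι) :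
    IsLocalizedModule.Away f (opcyclesMap η i).hom :=
  isLocalizedModule_opcyclesMap_of_tmul_one (Submonoid.powers f) _ K η hη i

end Cases

end Literature.Algebra.Homology
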